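import Mathlib
import HarnessLib
import Summits.NavierStokesRegularity.NavierStokesRegularity.Theorems.TaylorModelRungThreeVReadoutsDefs

/-!
# Line `taylor-model` on crux K1b-DR (stmt-NavierStokesRegularity-23954) — v3 (VECTOR STEP) semantic interface, part 3-W:
# the WINDOWED read-outs `WinData`, `ReadoutsVW`, `ValidVW`   [ns-tm-g4 g6, owner of the read-out layer (`…VReadoutsDefs` p625517)]

Definitions-only companion of `…VReadoutsDefs`.  WHY A SECOND READ-OUT PREDICATE: in `ReadoutsV` the crossing read-outs (R8),
the base landing (R9) and the landing-derivative bound (R11) are stated on the in-step boxes `Y^l = [ro.ylo l, ro.yhi l]`, which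
(R6) forces to contain every state of the LAST SUB-STEP `u ∈ [0, h (S−1)]`; (R10) likewise takes the derivative kernel over the
whole sub-step.  With an emitted last sub-step of ordinary length the centre's arc alone is `≈ 10⁶` polytope radii long
(finding 2026-08-28, stage 34 of the v5 data), so no certificate can pass (R9)/(R11) in that form, and the level-1 crossing spread
(`≈ 10⁻¹⁰`) forbids shrinking the sub-step to what level 0 needs (`≈ 4·10⁻¹²`).  `ReadoutsVW` keeps (R0)–(R7) of `ReadoutsV`
VERBATIM (same positions; (R6)/(R7) on the fat boxes give the strict monotonicity of the section value over the whole last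
sub-step, by which the G-side LOCATES the crossing) and restates the four crossing clauses on emitted CROSSING WINDOWS inside the
last sub-step, one per level, recorded in `WinData`:

* `WinData` — per level `l ∈ {0,1}` and stage `j`: the window `[ulo l j, uhi l j]` (offsets from `Tn (S−1)`) and the WINDOWED
  in-step box `[zlo l j, zhi l j]` (level 1: every polytope trajectory; level 0: the centre trajectory);
* `ReadoutsVW cd bx rd ro rw` — (R0)–(R7) as in `ReadoutsV`; then (R8w) crossing read-outs on `Z¹ ∩ {σf = lev}`; (R9w) base landing
  on `Z⁰ ∩ {σf = lev}`; (R10w) the derivative kernel `A(u)·(Vc + Cm·W) ∈ [Vlo, Vhi]` for in-step kernels at `u` in the LEVEL-1 WINDOW;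
  (R11w) the landing-derivative bound on `Z¹ ∩ {σf = lev}`; (W1) window order `0 ≤ ulo 1 ≤ ulo 0 ≤ uhi 0 ≤ uhi 1 ≤ h (S−1)`;
  (W2)/(W3) WINDOW-END SECTIONS: every in-step state (shape of (R6)) of a level-`l` hull start taken AT `u = ulo l` lies before the
  section (`σf < lev`) and AT `u = uhi l` after it (`lev < σf`) — with the monotonicity this puts every level-`l` crossing time
  inside the level-`l` window; (W4) WINDOWED IN-STEP BOXES: for `u ∈ [ulo l, uhi l]` the in-step states lie in `[zlo l, zhi l]`.
* `ValidVW cd bx rd ro rw := cd.Static ∧ cd.StageNumerics ∧ ChainV cd bx rd ∧ ReadoutsVW cd bx rd ro rw`.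

The K-side kernel `readoutStepWin` (`…CertificateReadoutVStepWin`) tests exactly these clauses; the G-side derives K1b-DR from
`ValidVW` (`…ReadoutV*Win`).  MODEL-lattice rung TL-M3 only; nothing here is a statement about the Navier–Stokes equations, and
nothing is asserted.
-/

noncomputable section

-- the sub-problem namespace repeats the summit name by design (D-0017)
set_option linter.dupNamespace false

namespace Summit.NavierStokesRegularity.NavierStokesRegularity.Theorems.TaylorModelV

open Set Literature.Analysis.FluidPDE.TaoCascade Literature.Analysis.FluidPDE.TaoCascade.TaylorChain
open Summit.NavierStokesRegularity.NavierStokesRegularity.Theorems.TaylorModelReadout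

/-- **Window record** of the windowed read-outs (per level `l : Fin 2` and stage `j`; junk beyond the indices used): the
crossing window `[ulo l j, uhi l j]` inside the last sub-step (offsets from `Tn (S−1)`) and the windowed in-step box
`[zlo l j, zhi l j]`. [folklore] -/
structure WinData where
  (ulo uhi : Fin 2 → ℕ → ℝ)
  (zlo zhi : Fin 2 → ℕ → (Fin 4 → ℤ → ℝ))

/-- **(TM-V windowed read-outs)** — see the module docstring for the clause list (R0)–(R7), (R8w)–(R11w), (W1)–(W4). [folklore] -/
def ReadoutsVW (cd : CertData) (bx : StepBoxes) (rd : RadiiData) (ro : ReadoutData) (rw : WinData) : Prop :=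
  ∀ j, j ≤ cd.N₀ →
    -- (R0) stage scalars, the base point, and the section functional reads the window only
    cd.Tn j (cd.S j) ≤ cd.τs ∧ InPoly cd j (cd.x j 0) ∧ 0 < cd.γ j ∧ 0 ≤ ro.ΛT j ∧
    (∀ y : Fin 4 → ℤ → ℝ, cd.σf j y = cd.σf j (trunc cd y)) ∧
    -- (R1) TUBE HULL: the level-1 hull inflated by `ΛT·κ·ω` lies in the outer hull, at every node
    (∀ s', s' ≤ cd.S j → ∀ y d : Fin 4 → ℤ → ℝ, InBox cd (bx.hlo 1 j s') (bx.hhi 1 j s') y →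
      cd.InBall j d (ro.ΛT j * cd.κ j) → InBox cd (bx.hlo 2 j s') (bx.hhi 2 j s') (y + d)) ∧
    -- (R2) TUBE GROWTH over every chain of real one-step kernels
    (∀ s₀ s₁, s₀ ≤ s₁ → s₁ ≤ cd.S j → ∀ A : ℕ → Ker,
      (∀ s', s₀ ≤ s' → s' < s₁ → KerMem cd (A s') (bx.Mlo j s') (bx.Mhi j s')) →
      ∀ (v : Fin 4 → ℤ → ℝ) (r : ℝ), 0 ≤ r → cd.InBall j v r →
        cd.InBall j (kiter cd A s₀ (s₁ - s₀) v) (ro.G j s₀ s₁ * r)) ∧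
    -- (R3) K1b-DR's `Λ` and the hull multiple `ΛT` from the forward factors `L1` and `G`
    (∀ a b, a < cd.S j → a + 1 ≤ b → b ≤ cd.S j →
      cd.L1 j a * ro.G j (a + 1) b ≤ ro.ΛT j ∧ (b < cd.S j → cd.L1 j a * ro.G j (a + 1) b * cd.L1 j b ≤ cd.Λ j)) ∧
    (∀ a, a < cd.S j → cd.L1 j a ≤ cd.Λ j) ∧
    -- (R4) window M-bounds per sub-step
    (∀ s', s' < cd.S j → ∀ i k, -cd.Kb ≤ k → k ≤ cd.Ka →
      -cd.M k ≤ bx.lo j s' i k + bx.loK j s' i k ∧ bx.hi j s' i k + bx.hiK j s' i k ≤ cd.M k ∧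
      -(cd.M k - cd.Λ j * cd.δ j * cd.τs * cd.ω j k - cd.mm) ≤ bx.lo j s' i k ∧
      bx.hi j s' i k ≤ cd.M k - cd.Λ j * cd.δ j * cd.τs * cd.ω j k - cd.mm) ∧
    -- (R5) section: before at node `S−1`, after at node `S` (level-1 hulls)
    (∀ y, InBox cd (bx.hlo 1 j (cd.S j - 1)) (bx.hhi 1 j (cd.S j - 1)) y → cd.σf j y < cd.lev j) ∧
    (∀ y, InBox cd (bx.hlo 1 j (cd.S j)) (bx.hhi 1 j (cd.S j)) y → cd.lev j < cd.σf j y) ∧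
    -- (R6) in-step boxes over the last sub-step (levels 0 and 1)
    (∀ l : Fin 2, ∀ u ∈ Icc 0 (cd.h j (cd.S j - 1)), ∀ A : Ker, InStepKer cd bx j (cd.S j - 1) u A →
      ∀ y, InBox cd (bx.hlo (hullLevel l) j (cd.S j - 1)) (bx.hhi (hullLevel l) j (cd.S j - 1)) y →
      ∀ r : Fin 4 → ℤ → ℝ, AbsLeW cd r (fun i k => bx.J j (cd.S j - 1) i k * u ^ (cd.pdeg + 1)) →
        InBox cd (ro.ylo l j) (ro.yhi l j) (cd.TP j (cd.S j - 1) u + r + kapp cd A (y - cd.x j (cd.S j - 1)))) ∧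
    -- (R7) transversality on the level-1 in-step box
    (∀ y, InBox cd (ro.ylo 1 j) (ro.yhi 1 j) y → cd.γ j ≤ cd.σf j (cd.Qb y y)) ∧
    -- (R8w) crossing read-outs on the WINDOWED level-1 box `Z¹ ∩ {σf = lev}`
    (∀ y, InBox cd (rw.zlo 1 j) (rw.zhi 1 j) y → cd.σf j y = cd.lev j →
      cd.as j ≤ |y cd.i₀ 1| ∧
      ∀ i, |y i (-cd.Kb)| + cd.Λ j * cd.δ j * cd.τs * cd.ω j (-cd.Kb) ≤
        (2:ℝ) ^ (-cd.θ) * (cd.Cb * (2:ℝ) ^ ((3:ℝ) / 4 * ((cd.Kb:ℝ) + 1)))) ∧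
    -- (R9w) base landing on the WINDOWED level-0 box `Z⁰ ∩ {σf = lev}`
    (∀ y, InBox cd (rw.zlo 0 j) (rw.zhi 0 j) y → cd.σf j y = cd.lev j → ∀ v, TailOK cd v → ∀ l,
      |cd.ℓ (cd.nx j) l (cd.land j y v) - cd.ctr (cd.nx j) l| + cd.β j l ≤ cd.rad (cd.nx j) l - cd.s (cd.nx j) l) ∧
    -- (R10w) derivative kernel over the LEVEL-1 WINDOW: in-step kernel ∘ (Vc + Cm·[Z]) ∈ [Vlo, Vhi]
    (∀ u ∈ Icc (rw.ulo 1 j) (rw.uhi 1 j), ∀ A : Ker, InStepKer cd bx j (cd.S j - 1) u A →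
      ∀ W : Ker, KerMem cd W (rd.Zlo j (cd.S j - 1)) (rd.Zhi j (cd.S j - 1)) →
        KerMem cd (kerOf fun v => kapp cd A (rd.Vc j (cd.S j - 1) v + cd.Cm j (cd.S j - 1) (kapp cd W v)))
          (ro.Vlo j) (ro.Vhi j)) ∧
    -- (R11w) landing derivative bound on the WINDOWED level-1 box (face-wise on the K-side)
    (∀ y, InBox cd (rw.zlo 1 j) (rw.zhi 1 j) y → cd.σf j y = cd.lev j →
      ∀ V : Ker, KerMem cd V (ro.Vlo j) (ro.Vhi j) →
      ∀ q ζ : Fin 4 → ℤ → ℝ, InPoly cd j q → (∀ i k, -cd.Kb ≤ k → k ≤ cd.Ka → q i k = (cd.x j 0 + rd.Dsc j ζ) i k) →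
      ∀ v, TailOK cd v → ∀ l,
        |cd.ℓ (cd.nx j) l (cd.landD j y v (secCorr cd j y (kapp cd V ζ)))| ≤ cd.β j l) ∧
    -- (W1) window order inside the last sub-step
    (0 ≤ rw.ulo 1 j ∧ rw.ulo 1 j ≤ rw.ulo 0 j ∧ rw.ulo 0 j ≤ rw.uhi 0 j ∧ rw.uhi 0 j ≤ rw.uhi 1 j ∧
      rw.uhi 1 j ≤ cd.h j (cd.S j - 1)) ∧
    -- (W2) window-end section BEFORE: every in-step state of a level-`l` hull start at `u = ulo l` has `σf < lev`
    (∀ l : Fin 2, ∀ A : Ker, InStepKer cd bx j (cd.S j - 1) (rw.ulo l j) A →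
      ∀ y, InBox cd (bx.hlo (hullLevel l) j (cd.S j - 1)) (bx.hhi (hullLevel l) j (cd.S j - 1)) y →
      ∀ r : Fin 4 → ℤ → ℝ, AbsLeW cd r (fun i k => bx.J j (cd.S j - 1) i k * rw.ulo l j ^ (cd.pdeg + 1)) →
        cd.σf j (cd.TP j (cd.S j - 1) (rw.ulo l j) + r + kapp cd A (y - cd.x j (cd.S j - 1))) < cd.lev j) ∧
    -- (W3) window-end section AFTER: every in-step state of a level-`l` hull start at `u = uhi l` has `lev < σf`
    (∀ l : Fin 2, ∀ A : Ker, InStepKer cd bx j (cd.S j - 1) (rw.uhi l j) A →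
      ∀ y, InBox cd (bx.hlo (hullLevel l) j (cd.S j - 1)) (bx.hhi (hullLevel l) j (cd.S j - 1)) y →
      ∀ r : Fin 4 → ℤ → ℝ, AbsLeW cd r (fun i k => bx.J j (cd.S j - 1) i k * rw.uhi l j ^ (cd.pdeg + 1)) →
        cd.lev j < cd.σf j (cd.TP j (cd.S j - 1) (rw.uhi l j) + r + kapp cd A (y - cd.x j (cd.S j - 1)))) ∧
    -- (W4) WINDOWED in-step boxes (levels 0 and 1)
    (∀ l : Fin 2, ∀ u ∈ Icc (rw.ulo l j) (rw.uhi l j), ∀ A : Ker, InStepKer cd bx j (cd.S j - 1) u A →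
      ∀ y, InBox cd (bx.hlo (hullLevel l) j (cd.S j - 1)) (bx.hhi (hullLevel l) j (cd.S j - 1)) y →
      ∀ r : Fin 4 → ℤ → ℝ, AbsLeW cd r (fun i k => bx.J j (cd.S j - 1) i k * u ^ (cd.pdeg + 1)) →
        InBox cd (rw.zlo l j) (rw.zhi l j) (cd.TP j (cd.S j - 1) u + r + kapp cd A (y - cd.x j (cd.S j - 1))))

/-- **The windowed v3 certificate predicate**: statics, stage numerics, the vector-step chain, the windowed read-outs. [folklore] -/
def ValidVW (cd : CertData) (bx : StepBoxes) (rd : RadiiData) (ro : ReadoutData) (rw : WinData) : Prop :=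
  cd.Static ∧ cd.StageNumerics ∧ ChainV cd bx rd ∧ ReadoutsVW cd bx rd ro rw

end Summit.NavierStokesRegularity.NavierStokesRegularity.Theorems.TaylorModelV

end
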